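import Literature.Computability.Complexity.ArthurMerlinGames
import Literature.Computability.Complexity.PRelHierarchy
import Literature.Computability.Complexity.BranchingFn
import Literature.Computability.Complexity.LengthCompare
import Literature.Computability.Complexity.CountingHierarchyPPoly
import Literature.Computability.Complexity.CoinCounting
import HarnessLib

/-!
# `AM(2) = BP·NP`: the two-move Arthur–Merlin game class is the operator class `AM` (proof)

Sibling proof file of `ArthurMerlinGames.lean` (D-0014). It DISCHARGES the named fact
`Literature.Computability.Complexity.AMk_two_eq_AM` — Arora–Barak's Remark 8.11(2) / Exercise 8.3
"`AM[2] = BP·NP`", there for the public-coin restriction of `IP[2]`, here for Babai–Moran's game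
class `AM(2)` (`AMk 2`: Arthur moves `y ∈ {0,1}^m` at random, Merlin answers `z ∈ {0,1}^m`, a
polynomial-time referee decides) against the tree's `AM = bp NP` (`ProbabilisticClasses.lean`) —
with the tree's `FinTM2` string toolkit (`pairFn`, `fstP`, `sndP`, `truncSndFn`, `LenLe`,
`LenEq`), by the textbook argument:

* `AM(2) ⊆ BP·NP` (`AMk_two_subset_AM`): for a referee `Ref ∈ P` and move length `m`, the
  `NP` language `L' = {⟨x, y⟩ | ∃ z ∈ {0,1}^{m(|x|)}, ⟨x, enc (y, z)⟩ ∈ Ref}` (verifier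
  `{⟨⟨x, y⟩, z⟩ | |z| = m(|x|) ∧ ⟨x, enc (y, z)⟩ ∈ Ref} ∈ P`) has, for coins `y ∈ {0,1}^{m(|x|)}`,
  `Pr_y[⟨x, y⟩ ∈ L'] =` the value of the game (`amValue_arthur_merlin`: Arthur averages, Merlin's
  node is worth `1` iff some answer wins), so the `2/3`–`1/3` gap of the game is the `BP·` gap;
* `BP·NP ⊆ AM(2)` (`AM_subset_AMk_two`): for `L' ∈ NP` with verifier `L'' ∈ P`, witness bound
  `q`, and coin polynomial `p`, play with moves of length `m = 2·q(2n+2+p(n)) + 2 + p(n)`: Arthur's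
  move `y` is read as the coin string `y↾p(|x|)`, Merlin's move `z` as the padded witness
  `⟨z', 0…0⟩` (`fstP z = z'`), and the referee accepts iff `|z'| ≤ q(|⟨x, y↾p⟩|)` and
  `⟨⟨x, y↾p⟩, z'⟩ ∈ L''`; the value is `Pr_{y ∈ {0,1}^m}[y↾p(|x|) ∈ E] = Pr_{y' ∈ {0,1}^{p(|x|)}}[E]`
  for `E = {y' | ⟨x, y'⟩ ∈ L'}` (cylinder lemma `uniformProb_take_of_le`).

Also proved on the way: the values of the one- and two-move games with a 0/1 referee payoff
(`amValue_merlin_eq_one/zero`, `amValue_arthur_eq`, `amValue_arthur_merlin`), reusable for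
`AM(1) = BPP`, `MA(1) = NP`.

## References

* S. Arora, B. Barak, *Computational Complexity: A Modern Approach*, CUP 2009, Remark 8.11 (2),
  Exercise 8.3 (`AM[2] = BP·NP`), Def. 7.17 (`BP·NP`), Def. 2.1 (witness bounds).
* L. Babai, S. Moran, *Arthur–Merlin games …*, JCSS 36 (1988), §1.3 (`AM = AM(2)`), §2.3.
-/

noncomputable section

namespace Literature.Computability.Complexity

open _root_.Computability Finset Polynomial AMPlayer

/-! ### Values of one- and two-move games with a 0/1 payoff -/

/-- Shorthand: the encoding of the move list used by referees. [folklore] -/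
abbrev encMoves (h : List (List Bool)) : List Bool := (encodingList Bool).listBool.encode h

/-- The encoding of a single move: `enc (y) = ⟨1, ⟨y, ε⟩⟩`. [folklore] -/
theorem encMoves_one (y : List Bool) : encMoves [y] = boolPair [true] (boolPair y []) := rfl

/-- The encoding of two moves: `enc (y, z) = ⟨11, ⟨y, ⟨z, ε⟩⟩⟩`. [folklore] -/
theorem encMoves_two (y z : List Bool) :
    encMoves [y, z] = boolPair [true, true] (boolPair y (boolPair z [])) := rfl

/-- **Merlin's last move is worth `1` if some move wins** (0/1 referee payoff).
[cite: BabaiMoran1988, §2.3] -/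
theorem gameValue_merlin_nil_eq_one {Ref : Language Bool} {x : List Bool} {m : ℕ}
    {h : List (List Bool)} (hex : ∃ y : List.Vector Bool m, boolPair x (encMoves (h ++ [y.toList])) ∈ Ref) :
    gameValue (refereePayoff Ref x) m [merlin] h = 1 := by
  obtain ⟨y, hy⟩ := hex
  apply le_antisymm
  · exact (gameValue_merlin_le_iff _ m [] h 1).2 fun y' => (refereePayoff_mem_Icc Ref x _).2
  · have h1 := le_gameValue_merlin (refereePayoff Ref x) m [] h y
    rwa [gameValue_nil, refereePayoff_of_mem hy] at h1

/-- **… and `0` otherwise.** [cite: BabaiMoran1988, §2.3] -/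
theorem gameValue_merlin_nil_eq_zero {Ref : Language Bool} {x : List Bool} {m : ℕ}
    {h : List (List Bool)} (hex : ¬ ∃ y : List.Vector Bool m, boolPair x (encMoves (h ++ [y.toList])) ∈ Ref) :
    gameValue (refereePayoff Ref x) m [merlin] h = 0 := by
  apply le_antisymm
  · exact (gameValue_merlin_le_iff _ m [] h 0).2 fun y' => by
      rw [gameValue_nil, refereePayoff_of_not_mem fun hy => hex ⟨y', hy⟩]
  · exact (gameValue_mem_Icc (refereePayoff_mem_Icc Ref x) m [merlin] h).1

/-- **Arthur's move averages a 0/1 outcome into a counting probability**: if after the move `y`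
the (sub)game is worth `1` when `Q y` and `0` otherwise, Arthur's node is worth
`Pr_{y ∈ {0,1}^m}[Q y]`. [cite: BabaiMoran1988, §2.3] -/
theorem gameValue_arthur_of_zeroOne {payoff : List (List Bool) → ℝ} {m : ℕ} {pat : List AMPlayer}
    {h : List (List Bool)} (Q : List Bool → Prop)
    (h1 : ∀ y : List.Vector Bool m, Q y.toList → gameValue payoff m pat (h ++ [y.toList]) = 1)
    (h0 : ∀ y : List.Vector Bool m, ¬ Q y.toList → gameValue payoff m pat (h ++ [y.toList]) = 0) :
    gameValue payoff m (arthur :: pat) h = uniformProb m {y | Q y} := by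
  rw [gameValue_arthur, uniformProb_eq_cnt_div, cnt]
  congr 1
  rw [Finset.natCast_card_filter]
  refine Finset.sum_congr rfl fun y _ => ?_
  by_cases hy : Q y.toList
  · rw [h1 y hy, if_pos (show y.toList ∈ {y | Q y} from hy)]
  · rw [h0 y hy, if_neg (show y.toList ∉ {y | Q y} from hy)]

/-- **Value of the one-move Arthur game `A`**: `Pr_{y ∈ {0,1}^m}[⟨x, enc (y)⟩ ∈ Ref]`.
[cite: BabaiMoran1988, §1.3 (AM(1))] -/
theorem amValue_arthur_eq (Ref : Language Bool) (m : ℕ) (x : List Bool) :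
    amValue Ref m [arthur] x = uniformProb m {y | boolPair x (encMoves [y]) ∈ Ref} := by
  unfold amValue
  refine gameValue_arthur_of_zeroOne (fun y => boolPair x (encMoves [y]) ∈ Ref)
    (fun y hy => ?_) (fun y hy => ?_)
  · rw [gameValue_nil, List.nil_append, refereePayoff_of_mem hy]
  · rw [gameValue_nil, List.nil_append, refereePayoff_of_not_mem hy]

/-- **Value of the two-move game `AM`**: `Pr_{y ∈ {0,1}^m}[∃ z ∈ {0,1}^m, ⟨x, enc (y, z)⟩ ∈ Ref]`
(Arthur averages; Merlin's node is worth `1` iff some answer wins). [cite: BabaiMoran1988, §2.3] -/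
theorem amValue_arthur_merlin (Ref : Language Bool) (m : ℕ) (x : List Bool) :
    amValue Ref m [arthur, merlin] x =
      uniformProb m {y | ∃ z : List.Vector Bool m, boolPair x (encMoves [y, z.toList]) ∈ Ref} := by
  unfold amValue
  refine gameValue_arthur_of_zeroOne
    (fun y => ∃ z : List.Vector Bool m, boolPair x (encMoves [y, z.toList]) ∈ Ref)
    (fun y hy => gameValue_merlin_nil_eq_one hy) (fun y hy => gameValue_merlin_nil_eq_zero hy)

/-- **Value of the one-move Merlin game `M`**: `1` if some move wins … [cite: BabaiMoran1988, §1.3 (MA(1))] -/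
theorem amValue_merlin_eq_one {Ref : Language Bool} {m : ℕ} {x : List Bool}
    (hex : ∃ y : List.Vector Bool m, boolPair x (encMoves [y.toList]) ∈ Ref) :
    amValue Ref m [merlin] x = 1 :=
  gameValue_merlin_nil_eq_one hex

/-- … and `0` otherwise. [cite: BabaiMoran1988, §1.3 (MA(1))] -/
theorem amValue_merlin_eq_zero {Ref : Language Bool} {m : ℕ} {x : List Bool}
    (hex : ¬ ∃ y : List.Vector Bool m, boolPair x (encMoves [y.toList]) ∈ Ref) :
    amValue Ref m [merlin] x = 0 :=
  gameValue_merlin_nil_eq_zero hex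

/-! ### `AM(2) ⊆ BP·NP` -/

namespace AMTwo

/-- `⟨⟨x, y⟩, z⟩ ↦ ⟨x, enc (y, z)⟩`: re-associate a verifier input into a referee input. [folklore] -/
def toRefFn : List Bool → List Bool :=
  pairFn (fstP ∘ fstP)
    (pairFn (fun _ => [true, true]) (pairFn fstP (pairFn sndP fun _ => [])) ∘ pairFn (sndP ∘ fstP) sndP)

/-- `toRefFn ⟨⟨x, y⟩, z⟩ = ⟨x, enc (y, z)⟩`. [folklore] -/
theorem toRefFn_apply (x y z : List Bool) :
    toRefFn (boolPair (boolPair x y) z) = boolPair x (encMoves [y, z]) := by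
  simp [toRefFn, encMoves_two, Function.comp_apply]

/-- `toRefFn ∈ FP`. [folklore] -/
theorem toRefFn_mem_FP : toRefFn ∈ FP :=
  pairFn_mem_FP (comp_mem_FP fstP_mem_FP fstP_mem_FP)
    (comp_mem_FP (pairFn_mem_FP (const_mem_FP _)
        (pairFn_mem_FP fstP_mem_FP (pairFn_mem_FP sndP_mem_FP (const_mem_FP _))))
      (pairFn_mem_FP (comp_mem_FP sndP_mem_FP fstP_mem_FP) sndP_mem_FP))

/-- `⟨⟨x, y⟩, z⟩ ↦ ⟨x, z⟩` (for the move-length test `|z| = m(|x|)`). [folklore] -/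
def lenFn : List Bool → List Bool := pairFn (fstP ∘ fstP) sndP

/-- `lenFn ⟨⟨x, y⟩, z⟩ = ⟨x, z⟩`. [folklore] -/
theorem lenFn_apply (x y z : List Bool) : lenFn (boolPair (boolPair x y) z) = boolPair x z := by
  simp [lenFn, Function.comp_apply]

/-- `lenFn ∈ FP`. [folklore] -/
theorem lenFn_mem_FP : lenFn ∈ FP :=
  pairFn_mem_FP (comp_mem_FP fstP_mem_FP fstP_mem_FP) sndP_mem_FP

/-- The `P` verifier of the `NP` language of the simulation: `⟨⟨x, y⟩, z⟩` is accepted iff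
`|z| = m(|x|)` and the referee accepts `⟨x, enc (y, z)⟩`. [cite: AroraBarakCC2009, Remark 8.11] -/
def verif (Ref : Language Bool) (m : Polynomial ℕ) : Language Bool :=
  {w | lenFn w ∈ LenEq m ∧ toRefFn w ∈ Ref}

/-- Membership of a triple in `verif`. [folklore] -/
theorem mem_verif_iff (Ref : Language Bool) (m : Polynomial ℕ) (x y z : List Bool) :
    boolPair (boolPair x y) z ∈ verif Ref m ↔
      z.length = m.eval x.length ∧ boolPair x (encMoves [y, z]) ∈ Ref := by
  change lenFn (boolPair (boolPair x y) z) ∈ LenEq m ∧ toRefFn (boolPair (boolPair x y) z) ∈ Ref ↔ _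
  rw [lenFn_apply, toRefFn_apply, boolPair_mem_LenEq]

/-- `verif Ref m ∈ P` for `Ref ∈ P`. [cite: AroraBarakCC2009, Remark 8.11] -/
theorem verif_mem_P {Ref : Language Bool} (hRef : Ref ∈ Classes.P) (m : Polynomial ℕ) :
    verif Ref m ∈ Classes.P := by
  have h := inter_mem_P (preimage_mem_P (LenEq_mem_P m) lenFn_mem_FP)
    (preimage_mem_P hRef toRefFn_mem_FP)
  exact h

/-- The `NP` language of the simulation: `w ∈ npLang` iff some `z` with `|z| ≤ m(|w|)` has
`⟨w, z⟩ ∈ verif` (literally a `polyExists` instance). [cite: AroraBarakCC2009, Remark 8.11] -/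
def npLang (Ref : Language Bool) (m : Polynomial ℕ) : Language Bool :=
  {w | ∃ z : List Bool, z.length ≤ m.eval w.length ∧ boolPair w z ∈ verif Ref m}

/-- `npLang Ref m ∈ NP` for `Ref ∈ P`. [cite: AroraBarakCC2009, Remark 8.11] -/
theorem npLang_mem_NP {Ref : Language Bool} (hRef : Ref ∈ Classes.P) (m : Polynomial ℕ) :
    npLang Ref m ∈ Nondeterministic.NP :=
  ⟨verif Ref m, verif_mem_P hRef m, m, fun _ => Iff.rfl⟩

/-- On pairs: `⟨x, y⟩ ∈ npLang ↔ ∃ z ∈ {0,1}^{m(|x|)}, ⟨x, enc (y, z)⟩ ∈ Ref` (the length bound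
`m(|x|) ≤ m(|⟨x, y⟩|)` by monotonicity of polynomials over `ℕ`). [folklore] -/
theorem boolPair_mem_npLang_iff (Ref : Language Bool) (m : Polynomial ℕ) (x y : List Bool) :
    boolPair x y ∈ npLang Ref m ↔
      ∃ z : List.Vector Bool (m.eval x.length), boolPair x (encMoves [y, z.toList]) ∈ Ref := by
  constructor
  · rintro ⟨z, -, hz⟩
    rw [mem_verif_iff] at hz
    exact ⟨⟨z, hz.1⟩, hz.2⟩
  · rintro ⟨z, hz⟩
    refine ⟨z.toList, ?_, (mem_verif_iff Ref m x y z.toList).2 ⟨z.toList_length, hz⟩⟩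
    rw [z.toList_length, length_boolPair]
    exact TM2Iter.eval_mono m (by omega)

end AMTwo

/-- **`AM(2) ⊆ BP·NP`.** [cite: AroraBarakCC2009, Remark 8.11] [cite: BabaiMoran1988, §1.3] -/
theorem AMk_two_subset_AM : AMk 2 ⊆ AM := by
  rintro L ⟨Ref, hRef, m, hL⟩
  refine ⟨AMTwo.npLang Ref m, AMTwo.npLang_mem_NP hRef m, m, fun x => ?_⟩
  have hval := amValue_arthur_merlin Ref (m.eval x.length) x
  have hpat : (arthur.alternate 2) = [arthur, merlin] := rfl
  obtain ⟨h1, h2⟩ := hL x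
  simp only [hpat] at h1 h2
  by_cases hx : x ∈ L
  · have h := h1 hx
    rw [hval] at h
    refine h.trans_eq (uniformProb_congr fun y _ => ?_)
    simp only [Set.mem_setOf_eq, hx, iff_true]
    exact (AMTwo.boolPair_mem_npLang_iff Ref m x y).symm
  · have h := h2 hx
    rw [hval] at h
    have hc := uniformProb_compl (m.eval x.length)
      {y | ∃ z : List.Vector Bool (m.eval x.length), boolPair x (encMoves [y, z.toList]) ∈ Ref}
    have hset : uniformProb (m.eval x.length)
        {y | boolPair x y ∈ AMTwo.npLang Ref m ↔ x ∈ L} =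
        uniformProb (m.eval x.length)
          {y | ∃ z : List.Vector Bool (m.eval x.length), boolPair x (encMoves [y, z.toList]) ∈ Ref}ᶜ :=
      uniformProb_congr fun y _ => by
        simp only [Set.mem_setOf_eq, hx, iff_false, Set.mem_compl_iff]
        exact not_congr (AMTwo.boolPair_mem_npLang_iff Ref m x y)
    rw [hset, hc]
    linarith

/-! ### `BP·NP ⊆ AM(2)` -/

namespace AMTwo

/-- The move length of the simulating game: `m(n) = 2·q(2n + 2 + p(n)) + 2 + p(n)` — room for a
padded witness of the `NP` verifier (bound `q`) on the pair `⟨x, y↾p(|x|)⟩` of length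
`2n + 2 + p(n)`, and at least the `p(n)` coins. [folklore] -/
def moveLen (p q : Polynomial ℕ) : Polynomial ℕ := 2 * q.comp (2 * X + 2 + p) + 2 + p

/-- Evaluation of `moveLen`. [folklore] -/
theorem eval_moveLen (p q : Polynomial ℕ) (n : ℕ) :
    (moveLen p q).eval n = 2 * q.eval (2 * n + 2 + p.eval n) + 2 + p.eval n := by
  simp [moveLen, eval_comp]

/-- `p(n) ≤ m(n)`. [folklore] -/
theorem eval_le_eval_moveLen (p q : Polynomial ℕ) (n : ℕ) : p.eval n ≤ (moveLen p q).eval n := by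
  rw [eval_moveLen]; omega

/-- The referee's input transformation `⟨x, enc (y, z)⟩ ↦ ⟨⟨x, y↾p(|x|)⟩, fst z⟩` (truncate
Arthur's move to the coins, unpad Merlin's move to the witness). [folklore] -/
def refInFn (p : Polynomial ℕ) : List Bool → List Bool :=
  pairFn (truncSndFn p ∘ pairFn fstP (fstP ∘ sndP ∘ sndP)) (fstP ∘ fstP ∘ sndP ∘ sndP ∘ sndP)

/-- `refInFn p ⟨x, enc (y, z)⟩ = ⟨⟨x, y↾p(|x|)⟩, fst z⟩`. [folklore] -/
theorem refInFn_apply (p : Polynomial ℕ) (x y z : List Bool) :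
    refInFn p (boolPair x (encMoves [y, z])) =
      boolPair (boolPair x (y.take (p.eval x.length))) (fstP z) := by
  simp [refInFn, encMoves_two, Function.comp_apply, truncSndFn_boolPair]

/-- `refInFn p ∈ FP`. [folklore] -/
theorem refInFn_mem_FP (p : Polynomial ℕ) : refInFn p ∈ FP :=
  pairFn_mem_FP
    (comp_mem_FP (truncSndFn_mem_FP p)
      (pairFn_mem_FP fstP_mem_FP (comp_mem_FP fstP_mem_FP (comp_mem_FP sndP_mem_FP sndP_mem_FP))))
    (comp_mem_FP fstP_mem_FP (comp_mem_FP fstP_mem_FP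
      (comp_mem_FP sndP_mem_FP (comp_mem_FP sndP_mem_FP sndP_mem_FP))))

/-- The referee of the simulating game: accept `⟨x, enc (y, z)⟩` iff the unpadded witness
`fst z` is within the verifier's bound, `|fst z| ≤ q(|⟨x, y↾p⟩|)`, and the verifier accepts
`⟨⟨x, y↾p⟩, fst z⟩`. [cite: AroraBarakCC2009, Remark 8.11] -/
def referee (L'' : Language Bool) (p q : Polynomial ℕ) : Language Bool :=
  {w | refInFn p w ∈ LenLe q ∧ refInFn p w ∈ L''}

/-- `referee L'' p q ∈ P` for `L'' ∈ P`. [cite: AroraBarakCC2009, Remark 8.11] -/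
theorem referee_mem_P {L'' : Language Bool} (hL'' : L'' ∈ Classes.P) (p q : Polynomial ℕ) :
    referee L'' p q ∈ Classes.P := by
  have h := preimage_mem_P (inter_mem_P (LenLe_mem_P q) hL'') (refInFn_mem_FP p)
  exact h

/-- Membership in the referee language. [folklore] -/
theorem mem_referee_iff (L'' : Language Bool) (p q : Polynomial ℕ) (x y z : List Bool) :
    boolPair x (encMoves [y, z]) ∈ referee L'' p q ↔
      (fstP z).length ≤ q.eval (boolPair x (y.take (p.eval x.length))).length ∧
        boolPair (boolPair x (y.take (p.eval x.length))) (fstP z) ∈ L'' := by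
  change refInFn p (boolPair x (encMoves [y, z])) ∈ LenLe q ∧
    refInFn p (boolPair x (encMoves [y, z])) ∈ L'' ↔ _
  rw [refInFn_apply, boolPair_mem_LenLe]

/-- **Padding a witness into a move**: `pad m z' = ⟨z', 0^{m - 2|z'| - 2}⟩` has length exactly `m`
when `2|z'| + 2 ≤ m`, and unpads to `z'` under `fstP`. [folklore] -/
def pad (m : ℕ) (z' : List Bool) : List Bool :=
  boolPair z' (List.replicate (m - (2 * z'.length + 2)) false)

/-- `fstP (pad m z') = z'`. [folklore] -/
@[simp] theorem fstP_pad (m : ℕ) (z' : List Bool) : fstP (pad m z') = z' := fstP_boolPair _ _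

/-- `|pad m z'| = m` when the witness fits. [folklore] -/
theorem length_pad {m : ℕ} {z' : List Bool} (h : 2 * z'.length + 2 ≤ m) : (pad m z').length = m := by
  simp only [pad, length_boolPair, List.length_replicate]
  omega

/-- **The value of the simulating game is the `BP·` probability**: for `|y| = m(|x|)`, some
answer `z ∈ {0,1}^m` wins iff the coin string `y↾p(|x|)` lies in `E = {y' | ⟨x, y'⟩ ∈ L'}`.
[cite: AroraBarakCC2009, Remark 8.11] -/
theorem exists_win_iff {L' L'' : Language Bool} {p q : Polynomial ℕ}
    (hq : ∀ w : List Bool, w ∈ L' ↔ ∃ z : List Bool, z.length ≤ q.eval w.length ∧ boolPair w z ∈ L'')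
    (x y : List Bool) (hy : y.length = (moveLen p q).eval x.length) :
    (∃ z : List.Vector Bool ((moveLen p q).eval x.length),
        boolPair x (encMoves [y, z.toList]) ∈ referee L'' p q) ↔
      boolPair x (y.take (p.eval x.length)) ∈ L' := by
  rw [hq]
  constructor
  · rintro ⟨z, hz⟩
    rw [mem_referee_iff] at hz
    exact ⟨fstP z.toList, hz.1, hz.2⟩
  · rintro ⟨z', hlen, hz'⟩
    have htake : (y.take (p.eval x.length)).length = p.eval x.length := by
      rw [List.length_take, min_eq_left]
      rw [hy]
      exact eval_le_eval_moveLen p q _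
    have hfit : 2 * z'.length + 2 ≤ (moveLen p q).eval x.length := by
      rw [length_boolPair, htake] at hlen
      rw [eval_moveLen]
      omega
    refine ⟨⟨pad _ z', length_pad hfit⟩, ?_⟩
    rw [mem_referee_iff]
    simp only [List.Vector.toList_mk, fstP_pad]
    exact ⟨hlen, hz'⟩

end AMTwo

/-- **`BP·NP ⊆ AM(2)`.** [cite: AroraBarakCC2009, Remark 8.11] [cite: BabaiMoran1988, §1.3] -/
theorem AM_subset_AMk_two : AM ⊆ AMk 2 := by
  rintro L ⟨L', hL', p, hp⟩
  obtain ⟨L'', hL'', q, hq⟩ := hL'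
  refine ⟨AMTwo.referee L'' p q, AMTwo.referee_mem_P hL'' p q, AMTwo.moveLen p q, fun x => ?_⟩
  have hpat : (arthur.alternate 2) = [arthur, merlin] := rfl
  simp only [hpat]
  rw [amValue_arthur_merlin]
  -- the value is the probability of the cylinder event `y↾p ∈ E`, i.e. `Pr_{p}[E]`
  have hcyl : uniformProb ((AMTwo.moveLen p q).eval x.length)
      {y | ∃ z : List.Vector Bool ((AMTwo.moveLen p q).eval x.length),
        boolPair x (encMoves [y, z.toList]) ∈ AMTwo.referee L'' p q} =
      uniformProb (p.eval x.length) {y' | boolPair x y' ∈ L'} := by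
    rw [← uniformProb_take_of_le (AMTwo.eval_le_eval_moveLen p q x.length)]
    exact uniformProb_congr fun y hy => AMTwo.exists_win_iff hq x y hy
  rw [hcyl]
  have hgap := hp x
  constructor
  · intro hx
    refine hgap.trans_eq (congrArg _ (Set.ext fun y' => ?_))
    simp only [Set.mem_setOf_eq, hx, iff_true]
  · intro hx
    have hset : {y' : List Bool | boolPair x y' ∈ L' ↔ x ∈ L} = {y' | boolPair x y' ∈ L'}ᶜ :=
      Set.ext fun y' => by simp only [Set.mem_setOf_eq, hx, iff_false, Set.mem_compl_iff]
    rw [hset, uniformProb_compl] at hgap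
    linarith

/-- **Discharge of `AMk_two_eq_AM`: `AM(2) = BP·NP`.** [cite: AroraBarakCC2009, Remark 8.11]
[cite: BabaiMoran1988, §1.3] -/
theorem AMk_two_eq_AM_holds : AMk_two_eq_AM :=
  Set.Subset.antisymm AMk_two_subset_AM AM_subset_AMk_two

end Literature.Computability.Complexity

end
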